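import Literature.Analysis.FluidPDE.ContinuousAlignmentTypeI
import HarnessLib

/-!
# A square-integrable-in-time `L^∞` bound on the gradient of the vorticity direction excludes
# Type I blow-up (Giga–Miura 2011, Corollary 2.6)

Topic `Analysis/FluidPDE`. Source: Y. Giga, H. Miura, *On vorticity directions near singularities
for the Navier–Stokes flows with infinite energy*, Comm. Math. Phys. **303** (2011) 289–300
[GigaMiura2011], read in the submitted text = Hokkaido University Preprint Series in Mathematics
#956 (30 March 2010), held in full (lit key `paper:url-45d04fdad14a`; per-page render
`run/shared/lean/pub/ns-regularity-ideate/ns-regularity-ideate-lit/renders/GM11-HokkaidoPreprint956-full/`,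
pp. 9–10). Companion of `Literature.Analysis.FluidPDE.ContinuousAlignmentTypeI` (Theorem 1.1, the
continuous-alignment criterion (CA) under Type I, `gigaMiura_continuousAlignment_typeI`) and of
`Literature.Analysis.FluidPDE.GigaMiura2011BlowupAnalysis` (§2.1, Props. 2.1–2.2, Lemma 2.3,
Cor. 2.4), whose frame and transcription conventions are used verbatim.

## The result, as printed (HUPS #956 p. 9; the render's subscript glyph `L1` is `L^∞`, see the
## render README's glyph caveat and p. 10, l. 1–3)

* **Corollary 2.6.** "Let `u` be a type I mild solution of (NS) for `ℝ³ × (−1, 0)`. For a given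
  `d > 0` assume that `∫_{−1}^{0} ‖∇ζ‖²_{L^∞(Ω_d(t))}(t) dt < +∞`, where `Ω_d(t)` is defined as
  Theorem 1.1 [`Ω_d(t) = {x ∈ ℝ³ : |ω(x,t)| > d}`, `ζ = ω/|ω|`, `ω = curl u`]. Then `u` does not
  blow up at `t = 0`."
* **Remark 2.7.** "Our assumption implies that `∇ζ` is identically zero. Hence `ζ` turns out to
  be a constant vector as in the proof of Proposition 2.2. Thus the proof is reduced to one of
  Theorem 1.1."
* **Remark 2.8** (p. 9–10). "In [BB], regularity of a weak solution of (NS) is established under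
  the assumption that `∫_{−1}^{0} ‖∇ζ‖^a_{L^b(Ω_d(t))}(t) dt < +∞` for `2/a + 3/b = 1/2`. This
  assumption is not scaling invariant while ours is scaling invariant. It is easy to generalize
  our assumption in this form with `2/a + 3/b = 1` and `2 ≤ a < ∞`."

Among the printed vorticity-direction regularity criteria (Constantin–Fefferman 1993, Beirão da
Veiga–Berselli 2002, Giga–Miura 2011 Thm 1.1) this is the one whose hypothesis is INTEGRATED IN
TIME, so that `‖∇ζ(t)‖_{L^∞(Ω_d(t))}` may be unbounded on a sparse set of times; it is cited by the
route `Summit.NavierStokesRegularity.NavierStokesRegularity.Theses.ScaledTopAlignment` as the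
nearest print ancestor of its most-times a-priori door `AprioriMostTimesBulkAlignment`
(stmt-NavierStokesRegularity-19551).

## Transcription into the tree's vocabulary

Exactly as for Theorem 1.1 (`ContinuousAlignmentTypeI.lean`): the solution is a classical unforced
Navier–Stokes solution of viscosity `ν > 0` on `ℝ³ × [0, T)` (`IsClassicalNSSolutionOn (Ico 0 T) ν 0 u p`),
Leray–Hopf on `[0, T)` (`IsLerayHopfOn T ν 0 (u 0) u`, which excludes the parasitic non-mild
solutions), bounded on each `[0, T'] × ℝ³`, `T' < T`; the Type I hypothesis at `T` is
`IsTypeIBlowup u T`; `(−1, 0)` with `ν = 1` becomes `(0, T)` with viscosity `ν` (translation +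
Navier–Stokes scaling, under which the hypothesis is invariant); "does not blow up at `t = 0`" is
recorded as `HasSmoothExtensionPast ν 0 u T`. The vorticity direction is
`ξ(t) = vorticityDirection (curl (u t))` (`= ω/|ω|`), its gradient the Fréchet derivative
`fderiv ℝ (ξ t) x : ℝ³ →L[ℝ] ℝ³` with the operator norm (any norm on `3 × 3` matrices gives the same
integrability class), and the printed `∫_{−1}^{0} ‖∇ζ‖²_{L^∞(Ω_d(t))} dt < +∞` is rendered by a
measurable majorant `g : ℝ → [0, ∞]` of `t ↦ ‖∇ξ(t)‖_{L^∞(Ω_d(t))}` with `∫_{(0,T)} g² < ∞`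
(`‖D(ξ t) x‖ₑ ≤ g t` whenever `t ∈ (0,T)` and `|ω(t,x)| > d`). For the classical solutions of the
frame the printed function `t ↦ sup_{Ω_d(t)} ‖∇ξ(t, ·)‖` is itself such a majorant (it is lower
semicontinuous — the supremum over an open `t`-dependent set of a jointly continuous quantity —
hence measurable), so the two readings are equivalent.

## Status

PROVED in the tree, Summits side (the proof uses the NS-ladder cell's Type-I zoom kit, which lives
under `Summits/`): `Summit.NavierStokesRegularity.NavierStokesRegularity.Theorems.hasSmoothExtensionPast_of_directionGradient_sqIntegrable_typeI`
(`Theorems/ScaledTopAlignmentGigaMiuraDirectionGradient.lean`: flexible Type-I zoom with locally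
uniform slice convergence, an a.e.-slice selection by Fatou on the tail of `∫ g²`, the mean-value
inequality on the zoomed direction field inside the top region, and the window rigidity of
Type-I ancient mild solutions). The discharge `…_holds` of this named statement is filed next to
that theorem.

## Mathlib / tree search

`lean search 'directionGradient|Corollary 2.6|nabla zeta'`: no prior declaration of Cor. 2.6
(2026-08-26); the typer's SOURCE-DECL-MAP (HOME/ns-regularity-ideate-typer) listed it as untyped.
Reused: `IsClassicalNSSolutionOn`, `IsLerayHopfOn`, `IsTypeIBlowup`, `HasSmoothExtensionPast`,
`curl`, `vorticityDirection`.

## References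

* Y. Giga, H. Miura, Comm. Math. Phys. 303 (2011) 289–300 = HUPS #956: Cor. 2.6, Rmk. 2.7–2.8
  (pp. 9–10), Thm 1.1 (p. 3), §2.1 (pp. 5–9). [GigaMiura2011]
* H. Beirão da Veiga, L. C. Berselli, Differential Integral Equations 15 (2002) 345–356.
  [BeiraodaVeigaBerselli2002]
-/

open Set Filter MeasureTheory
open scoped ENNReal

namespace Literature.Analysis.FluidPDE

/-- **Giga–Miura 2011, Corollary 2.6 (a square-integrable-in-time `L^∞` bound on the gradient of
the vorticity direction over the top region excludes Type I blow-up; whole space).** Let `ν > 0`,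
`T > 0`, and let `(u, p)` be a classical unforced Navier–Stokes solution on `ℝ³ × [0, T)` which is
Leray–Hopf on `[0, T)` and bounded on `ℝ³ × [0, T']` for every `T' < T`. Assume the possible blow-up
at `T` is of Type I (`IsTypeIBlowup u T`), and assume that for some `d > 0` the function
`t ↦ ‖∇ξ(t)‖_{L^∞(Ω_d(t))}`, `Ω_d(t) = {x : |ω(x,t)| > d}`, `ω = curl (u t)`,
`ξ = vorticityDirection ω = ω/|ω|`, is square-integrable on `(0, T)` — rendered by a measurable
majorant `g : ℝ → [0, ∞]` with `∫_{(0,T)} g(t)² dt < ∞` and `‖D(ξ(t))(x)‖ ≤ g(t)` (operator norm of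
the Fréchet derivative) at every `t ∈ (0, T)` and every `x` with `|ω(t,x)| > d`. Then `T` is not a
blow-up time: `u` continues as a classical solution past `T` (`HasSmoothExtensionPast ν 0 u T`).
Printed for Type I mild solutions on `ℝ³ × (−1, 0)` with viscosity `1` and the hypothesis
`∫_{−1}^{0} ‖∇ζ‖²_{L^∞(Ω_d(t))}(t) dt < +∞`; transcription (interval, viscosity, "does not blow up"
↦ continuation) exactly as for the tree's `gigaMiura_continuousAlignment_typeI` (Thm 1.1). The
printed exponent pair `(2, ∞)` is the `a = 2` member of the scaling-invariant family
`∇ζ ∈ L^a(L^b(Ω_d))`, `2/a + 3/b = 1` (Rmk. 2.8). PROVED in the tree (Summits side, the cell's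
Type-I zoom kit): `Summit.NavierStokesRegularity.NavierStokesRegularity.Theorems.hasSmoothExtensionPast_of_directionGradient_sqIntegrable_typeI`
(`Theorems/ScaledTopAlignmentGigaMiuraDirectionGradient.lean`), whose type is this statement.
[cite: GigaMiura2011, Cor. 2.6 with Rmk. 2.7 (§2.1; HUPS preprint #956 p. 9)] -/
def gigaMiura2011_directionGradient_typeI : Prop :=
  ∀ {ν T : ℝ} (_hν : 0 < ν) (_hT : 0 < T)
    {u : ℝ → EuclideanSpace ℝ (Fin 3) → EuclideanSpace ℝ (Fin 3)}
    {p : ℝ → EuclideanSpace ℝ (Fin 3) → ℝ}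
    (_h : IsClassicalNSSolutionOn (Ico 0 T) ν 0 u p) (_hLH : IsLerayHopfOn T ν 0 (u 0) u)
    (_hbdd : ∀ T' < T, ∃ M : ℝ, ∀ t ∈ Icc 0 T', ∀ x, ‖u t x‖ ≤ M)
    (_htypeI : IsTypeIBlowup u T)
    (_hD : ∃ d : ℝ, 0 < d ∧ ∃ g : ℝ → ℝ≥0∞, Measurable g ∧ (∫⁻ t in Ioo 0 T, g t ^ 2) < ∞ ∧
      ∀ t ∈ Ioo 0 T, ∀ x : EuclideanSpace ℝ (Fin 3), d < ‖curl (u t) x‖ →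
        ‖fderiv ℝ (vorticityDirection (curl (u t))) x‖ₑ ≤ g t),
    HasSmoothExtensionPast ν 0 u T

/-- **Giga–Miura 2011, Remark 2.8 (the scaling-invariant family `∇ζ ∈ L^a(L^b(Ω_d))`,
`2/a + 3/b = 1`; exponents `2 < a < ∞`, `3 < b < ∞`).** Let `ν > 0`, `T > 0`, and let `(u, p)` be
a classical unforced Navier–Stokes solution on `ℝ³ × [0, T)` which is Leray–Hopf on `[0, T)` and
bounded on `ℝ³ × [0, T']` for every `T' < T`, with a possible blow-up at `T` of Type I
(`IsTypeIBlowup u T`). If for some `d > 0`, some `3 < b < ∞` and `a` with `2/a + 3/b = 1`, the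
function `t ↦ ‖∇ξ(t)‖_{L^b(Ω_d(t))}` (`Ω_d(t) = {x : |ω(x,t)| > d}`, `ξ = ω/|ω|`, operator norm of
the Fréchet derivative; `eLpNorm (D ξ(t)) b (volume.restrict Ω_d(t))`) admits a measurable
majorant `G : ℝ → [0, ∞]` with `∫_{(0,T)} G^a < ∞`, then `u` continues as a classical solution past
`T`. Printed as a remark after Cor. 2.6 (HUPS #956 p. 10): "[BB]'s assumption
`∫‖∇ζ‖^a_{L^b(Ω_d(t))} dt < +∞` for `2/a + 3/b = 1/2` … is not scaling invariant while ours is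
scaling invariant. It is easy to generalize our assumption in this form with `2/a + 3/b = 1` and
`2 ≤ a < ∞`"; the endpoint `(a, b) = (2, ∞)` is Cor. 2.6 (`gigaMiura2011_directionGradient_typeI`).
PROVED in the tree (Summits side): `Summit.NavierStokesRegularity.NavierStokesRegularity.Theorems.hasSmoothExtensionPast_of_directionGradient_LaLb_typeI`
(`Theorems/ScaledTopAlignmentGigaMiuraDirectionGradientLaLb.lean`: Type-I zoom, Morrey's inequality
on the zoomed ball, window rigidity), whose type is this statement.
[cite: GigaMiura2011, Rmk. 2.8 with Cor. 2.6 / Rmk. 2.7 (§2.1; HUPS preprint #956 pp. 9–10)] -/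
def gigaMiura2011_directionGradient_LaLb_typeI : Prop :=
  ∀ {ν T : ℝ} (_hν : 0 < ν) (_hT : 0 < T)
    {u : ℝ → EuclideanSpace ℝ (Fin 3) → EuclideanSpace ℝ (Fin 3)}
    {p : ℝ → EuclideanSpace ℝ (Fin 3) → ℝ}
    (_h : IsClassicalNSSolutionOn (Ico 0 T) ν 0 u p) (_hLH : IsLerayHopfOn T ν 0 (u 0) u)
    (_hbdd : ∀ T' < T, ∃ M : ℝ, ∀ t ∈ Icc 0 T', ∀ x, ‖u t x‖ ≤ M)
    (_htypeI : IsTypeIBlowup u T) {a : ℝ} {b : NNReal} (_hb3 : 3 < (b : ℝ))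
    (_hab : 2 / a + 3 / (b : ℝ) = 1)
    (_hD : ∃ d : ℝ, 0 < d ∧ ∃ G : ℝ → ℝ≥0∞, Measurable G ∧ (∫⁻ t in Ioo 0 T, G t ^ a) < ∞ ∧
      ∀ t ∈ Ioo 0 T, eLpNorm (fderiv ℝ (vorticityDirection (curl (u t)))) (b : ℝ≥0∞)
        (volume.restrict {x | d < ‖curl (u t) x‖}) ≤ G t),
    HasSmoothExtensionPast ν 0 u T

end Literature.Analysis.FluidPDE
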